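import Mathlib
import Literature.NumberTheory.LFunctions.Zhang2022.TypedSection16BLemma162Rp
import Literature.NumberTheory.LFunctions.Zhang2022.Section16BNormaliserRBounds
import Literature.NumberTheory.LFunctions.Zhang2022.Section15CU055Residue
import Literature.NumberTheory.LFunctions.Zhang2022.Section3Lemma31
import Literature.NumberTheory.LFunctions.Zhang2022.AppendixALemma83LocalEstimates
import HarnessLib

/-!
# Zhang (2022) §16 p. 94, u041 for the repaired integrand: the residue at the simple pole `s = β_j`
# is negligible (`‖Res_{s=β_j}‖ ≤ 𝓛⁻⁴`)

Topic `Literature/NumberTheory/LFunctions/Zhang2022` (Landau–Siegel audit tree; verdict-neutral).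
Y. Zhang, *Discrete mean estimates and the Landau–Siegel zero*, arXiv:2211.02515v1 (2022)
[Zhang2022LandauSiegel] — **an unrefereed manuscript under adjudication; nothing here asserts or
denies its Theorems 1–2.** ZHANG-L lane, WP16 Block C (sub-leaf `Typed.Section16B.Step16_u041aR` of
`h16_16 → Eq16_16R2E`; row G-d57-1), cut (C4) of the owner's carve (zl-libC-p1, 2026-08-27T01:33Z).

"We can move the contour of integration in the same way as in the proof of Lemma 8.4" (§16 p. 94,
after Lemma 16.2, tex L4665–L4667) for the repaired integrand
`ζ(1+s)²ζ(1+s−β_j)L(1+s,χ)L(1+s−β_j,χ)²E₂ⱼ(1+s)T^sω₁(s)/s` (`Typed.Section16B.integrand16_u040R`)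
meets two poles: the triple pole at `s = 0` (main term `L′(1,χ)³E₂ⱼ(1)`, cut (C1)) and the SIMPLE
POLE at `s = β_j` coming from `ζ(1+s−β_j) = (s−β_j)⁻¹ζ₁(1+s−β_j)` (Mathlib `riemannZeta₁`). Its
residue is the value at `β_j` of
`φ_β(z) = ζ(1+z)²·ζ₁(1+z−β_j)·L(1+z,χ)·L(1+z−β_j,χ)²·E₂ⱼ(1+z)·(T^z ω₁(z)/z)`, i.e.
`ζ(1+β_j)²·ζ₁(1)·L(1+β_j,χ)·L(1,χ)²·E₂ⱼ(1+β_j)·T^{β_j}ω₁(β_j)/β_j`, and it carries the factor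
`L(1,χ)²`: under (A) (`L(1,χ) < 𝓛⁻²⁰²²`) it is far below the admissible error `𝓛⁻⁴`.
Quantitatively (all eventually in `D`, `𝓛 = log D`, `α = π/𝓛⁹`, `α/2 ≤ |β_j| ≤ 7α` for `j = 1,2`):
`|ζ(1+β_j)| ≤ 1/|β_j| + 64 ≤ 𝓛⁹` (tree `Typed.Section16B.norm_riemannZeta_one_add_le`),
`ζ₁(1) = 1`, `|L(1+β_j,χ)| ≤ |L(1,χ)| + 2e^{9/2}(1+𝓛)𝓛·|β_j| ≤ 2`
(`Lemma31.norm_LFunction_one_add_sub_le`), `|L(1,χ)|² ≤ 𝓛⁻⁴⁰⁴⁴` ((A)),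
`|E₂ⱼ(1+β_j)| ≤ C𝓛` (the near-one clause (v) of `Lemma162Rq`, transported to `frakU2R` by
`frakU2R_near_one_bound_of_lemma162Rq_inv`), `|T^{β_j}| = 1`, `|ω₁(β_j)| ≤ 2`
(`U055.norm_omega1_le_two`), `1/|β_j| ≤ 2/α ≤ 2𝓛⁹`: product `≤ 8C·𝓛²⁸⁻⁴⁰⁴⁴ ≤ 𝓛⁻⁴`.

Main result: `norm_resBeta_le` (and the lambda-applied spelling `norm_resBeta_le'` matching the
owner's `φ β β`). Theorems only; 0 definitions; standard axioms.

## References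

* Y. Zhang, arXiv:2211.02515v1 (2022), §16 p. 94 (u041), Lemma 16.2; §8 Lemma 8.4 pp. 44–46.
  [cite: Zhang2022LandauSiegel, §16 p.94 (u041)]
-/

noncomputable section

open Complex Real
open Literature.NumberTheory.LFunctions.Zhang2022
open Literature.NumberTheory.LFunctions.Zhang2022.Skeleton
open Literature.NumberTheory.LFunctions.Zhang2022.Typed.Section16B

namespace Literature.NumberTheory.LFunctions.Zhang2022.U041

/-! ### Scale bookkeeping (private) -/

/-- `α = π/𝓛⁹`. [folklore] -/
private theorem alpha_eq (D : ℕ) : alpha D = π / ell D ^ 9 := by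
  rw [alpha, bigP, Real.log_exp]

/-- Eventually `L₀ ≤ 𝓛`. [folklore] -/
private theorem forAllLarge_le_ell (L₀ : ℝ) : ForAllLarge fun D _ _ => L₀ ≤ ell D := by
  refine ForAllLarge.of_le ⌈Real.exp L₀⌉₊ fun D _ χ hD _ _ => ?_
  have h1 : Real.exp L₀ ≤ D := (Nat.le_ceil _).trans (by exact_mod_cast hD)
  rw [ell]
  exact (Real.le_log_iff_exp_le (lt_of_lt_of_le (Real.exp_pos _) h1)).mpr h1

/-- The shift sizes for `j = 1, 2` once `|c′α𝓛| ≤ 1/10`: `α/2 ≤ |β_j|`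
(`β₁ = iα(1−5c′α𝓛)`, `β₂ = 2iα(1+c′α𝓛)`). [folklore] -/
private theorem half_alpha_le_norm_betaJ (c' : ℝ) {D : ℕ} (hα : 0 < alpha D)
    (hc : |c' * alpha D * ell D| ≤ 1 / 10) {j : ℕ} (hj : j ∈ ({1, 2} : Finset ℕ)) :
    alpha D / 2 ≤ ‖betaJ c' D j‖ := by
  have hx := abs_le.mp hc
  simp only [Finset.mem_insert, Finset.mem_singleton] at hj
  rcases hj with rfl | rfl
  · have h1 : betaJ c' D 1 = beta1 c' D := by simp [betaJ]
    rw [h1, beta1, norm_mul, norm_mul, Complex.norm_I, one_mul, Complex.norm_real, Complex.norm_real,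
      Real.norm_of_nonneg hα.le, Real.norm_eq_abs]
    have h2 : 1 / 2 ≤ |1 - 5 * c' * alpha D * ell D| := by
      rw [show 5 * c' * alpha D * ell D = 5 * (c' * alpha D * ell D) by ring]
      refine le_trans ?_ (le_abs_self _)
      linarith
    nlinarith
  · have h1 : betaJ c' D 2 = beta2 c' D := by simp [betaJ]
    rw [h1, beta2, norm_mul, norm_mul, norm_mul, Complex.norm_I, Complex.norm_real,
      Complex.norm_real, Real.norm_of_nonneg hα.le, Real.norm_eq_abs]
    have h2 : 1 / 2 ≤ |1 + c' * alpha D * ell D| := by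
      refine le_trans ?_ (le_abs_self _)
      linarith
    have h3 : ‖(2 : ℂ)‖ = 2 := by simp
    rw [h3, mul_one]
    nlinarith

/-! ### The residue at `β_j` -/

/-- **The residue at the simple pole `s = β_j` is negligible** (cut (C4) of WP16 Block C): under
`Lemma162Rq c′` (near-one clause (v): `‖E₂ⱼ(s)‖ ≤ C𝓛` for `‖s−1‖ ≤ 𝓛⁻¹`, transported to `frakU2R`),
for all large `D`, every real primitive `χ (mod D)` with (A) and `j ∈ {1, 2}`:
`‖ζ(1+β_j)²·ζ₁(1+β_j−β_j)·L(1+β_j,χ)·L(1+β_j−β_j,χ)²·E₂ⱼ(1+β_j)·(T^{β_j}ω₁(β_j)/β_j)‖ ≤ 𝓛⁻⁴`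
(`T = bigT D`, `ω₁` with `Λ = 𝓛³⁰`, `E₂ⱼ = frakU2R c′ χ j`). The bound is in fact
`≤ 8C·𝓛²⁸·𝓛⁻⁴⁰⁴⁴` (the residue carries `L(1,χ)²`). [cite: Zhang2022LandauSiegel, §16 p.94 (u041)] -/
theorem norm_resBeta_le (c' : ℝ) (hRq : Lemma162Rq c') :
    ForAllLarge fun D _ χ => AssumptionA D χ → ∀ j ∈ ({1, 2} : Finset ℕ),
      ‖riemannZeta (1 + betaJ c' D j) ^ 2 * riemannZeta₁ (1 + betaJ c' D j - betaJ c' D j) *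
          χ.LFunction (1 + betaJ c' D j) * χ.LFunction (1 + betaJ c' D j - betaJ c' D j) ^ 2 *
          frakU2R c' χ j (1 + betaJ c' D j) *
          ((bigT D : ℂ) ^ betaJ c' D j * GaussWeight.omega1 (ell D ^ 30) (betaJ c' D j) /
            betaJ c' D j)‖ ≤
        (ell D ^ 4)⁻¹ := by
  obtain ⟨C, hnear⟩ := frakU2R_near_one_bound_of_lemma162Rq_inv c' hRq
  set C₀ : ℝ := max C 0 with hC₀def
  have hC₀ : 0 ≤ C₀ := le_max_right _ _
  have hCC₀ : C ≤ C₀ := le_max_left _ _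
  have hL := forAllLarge_le_ell (max (10 * |c'| * π + 400) (8 * C₀ + 4))
  refine (hnear.and hL).mono ?_
  intro D _ χ _ hp hD hA j hj
  obtain ⟨hnearD, hLD⟩ := hD
  obtain ⟨-, -, -, hv, -⟩ := hnearD hA j hj
  -- scales
  have hL1 : 10 * |c'| * π + 400 ≤ ell D := le_trans (le_max_left _ _) hLD
  have hL2 : 8 * C₀ + 4 ≤ ell D := le_trans (le_max_right _ _) hLD
  have hℓ400 : (400 : ℝ) ≤ ell D := by nlinarith [abs_nonneg c', Real.pi_pos]
  have hℓ4 : (4 : ℝ) ≤ ell D := by linarith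
  have hℓpos : (0 : ℝ) < ell D := by linarith
  have hℓne : ell D ≠ 0 := hℓpos.ne'
  have hD0 : (0 : ℝ) < D := by exact_mod_cast Nat.pos_of_ne_zero (NeZero.ne D)
  have hexpD : Real.exp (10 * |c'| * π + 400) ≤ D := by
    have h : 10 * |c'| * π + 400 ≤ Real.log D := hL1
    exact (Real.le_log_iff_exp_le hD0).mp h
  obtain ⟨hℓ3, hα, hbsum, -⟩ := Lemma83.largeD_bounds c' hexpD
  have hαeq := alpha_eq D
  -- `|c' α 𝓛| ≤ 1/10`
  have hcαℓ : |c' * alpha D * ell D| ≤ 1 / 10 := by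
    rw [abs_mul, abs_mul, abs_of_pos hα, abs_of_pos hℓpos]
    have hαℓ' : alpha D * ell D = π / ell D ^ 8 := by
      rw [hαeq]; field_simp
    have hc : 10 * (|c'| * π) ≤ ell D := by nlinarith [Real.pi_pos]
    have hℓ8 : ell D ≤ ell D ^ 8 := by
      calc ell D = ell D ^ 1 := (pow_one _).symm
        _ ≤ ell D ^ 8 := pow_le_pow_right₀ (by linarith) (by norm_num)
    rw [mul_assoc, hαℓ', mul_div_assoc', div_le_iff₀ (by positivity)]
    nlinarith
  -- size of `β_j`
  set β : ℂ := betaJ c' D j with hβdef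
  have hβre : β.re = 0 := betaJ_re_eq_zero c' D j
  have hβle : ‖β‖ ≤ 7 * alpha D := (Lemma83.norm_betaJ_le c' D j).trans hbsum
  have hβge : alpha D / 2 ≤ ‖β‖ := half_alpha_le_norm_betaJ c' hα hcαℓ hj
  have hβpos : 0 < ‖β‖ := lt_of_lt_of_le (by positivity) hβge
  have hβ0 : β ≠ 0 := norm_pos_iff.mp hβpos
  -- `7α ≤ 1/𝓛` and friends
  have hαsmall : 7 * alpha D ≤ (ell D)⁻¹ := by
    rw [hαeq, ← one_div, show 7 * (π / ell D ^ 9) = 7 * π / ell D ^ 9 by ring,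
      div_le_div_iff₀ (by positivity) hℓpos]
    have h48 : (4 : ℝ) ^ 8 ≤ ell D ^ 8 := pow_le_pow_left₀ (by norm_num) hℓ4 8
    have hπℓ : π * ell D < 4 * ell D := mul_lt_mul_of_pos_right Real.pi_lt_four hℓpos
    have h9 : ell D ^ 9 = ell D * ell D ^ 8 := by ring
    rw [h9]
    nlinarith
  have hβinv : ‖β‖ ≤ (ell D)⁻¹ := hβle.trans hαsmall
  have hβhalf : ‖β‖ < 1 / 2 := by
    have : (ell D)⁻¹ ≤ (4 : ℝ)⁻¹ := inv_anti₀ (by norm_num) hℓ4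
    linarith
  have hβone : ‖β‖ ≤ 1 := by linarith
  -- (f1) `‖ζ(1+β)‖ ≤ 𝓛⁹`
  have hζ : ‖riemannZeta (1 + β)‖ ≤ ell D ^ 9 := by
    have h := norm_riemannZeta_one_add_le (s := β) (by rw [hβre]; norm_num) hβ0
    have h1 : 1 / ‖β‖ ≤ 2 / alpha D := by
      rw [div_le_div_iff₀ hβpos hα]; linarith
    have h2 : (3 + ‖β‖) ^ 3 ≤ 64 := by
      calc (3 + ‖β‖) ^ 3 ≤ (4 : ℝ) ^ 3 := pow_le_pow_left₀ (by positivity) (by linarith) 3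
        _ = 64 := by norm_num
    have h3 : 2 / alpha D = 2 * ell D ^ 9 / π := by rw [hαeq]; field_simp
    have h4 : 2 * ell D ^ 9 / π ≤ 2 * ell D ^ 9 / 3 :=
      div_le_div_of_nonneg_left (by positivity) (by norm_num) Real.pi_gt_three.le
    have h5 : (64 : ℝ) ≤ ell D ^ 9 / 3 := by
      have : (4 : ℝ) ^ 9 ≤ ell D ^ 9 := pow_le_pow_left₀ (by norm_num) hℓ4 9
      linarith
    calc ‖riemannZeta (1 + β)‖ ≤ 1 / ‖β‖ + (3 + ‖β‖) ^ 3 := h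
      _ ≤ 2 / alpha D + 64 := add_le_add h1 h2
      _ ≤ 2 * ell D ^ 9 / 3 + ell D ^ 9 / 3 := by rw [h3]; exact add_le_add h4 h5
      _ = ell D ^ 9 := by ring
  -- (f4) `‖L(1,χ)‖ ≤ 𝓛⁻²⁰²² ≤ 1`
  have hD3 : 3 ≤ Real.log D := hℓ3
  have hA' : ‖χ.LFunction 1‖ < 1 / ell D ^ 2022 := hA
  have hAle : ‖χ.LFunction 1‖ ≤ 1 / ell D ^ 2022 := hA'.le
  have hL1le : ‖χ.LFunction 1‖ ≤ 1 := by
    have : 1 / ell D ^ 2022 ≤ 1 := by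
      rw [div_le_one (by positivity)]
      exact one_le_pow₀ (by linarith)
    linarith
  -- (f3) `‖L(1+β,χ)‖ ≤ 2`
  have hLβ : ‖χ.LFunction (1 + β)‖ ≤ 2 := by
    have hz : ‖β‖ ≤ 1 / Real.log D := by rw [one_div]; exact hβinv
    have h : ‖χ.LFunction (1 + β) - χ.LFunction 1‖ ≤
        2 * Real.exp (9 / 2) * (1 + ell D) * ell D * ‖β‖ :=
      Lemma31.norm_LFunction_one_add_sub_le χ hD3 hp hz
    have he : Real.exp (9 / 2) ≤ 149 := by
      have h1 : Real.exp (9 / 2) ≤ Real.exp 5 := Real.exp_le_exp.mpr (by norm_num)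
      have h2 : Real.exp 5 = Real.exp 1 ^ 5 := by rw [← Real.exp_nat_mul]; norm_num
      have h3 : Real.exp 1 ^ 5 ≤ (2.7182818286 : ℝ) ^ 5 :=
        pow_le_pow_left₀ (Real.exp_pos 1).le Real.exp_one_lt_d9.le 5
      have h4 : (2.7182818286 : ℝ) ^ 5 ≤ 149 := by norm_num
      calc Real.exp (9 / 2) ≤ Real.exp 5 := h1
        _ = Real.exp 1 ^ 5 := h2
        _ ≤ (2.7182818286 : ℝ) ^ 5 := h3
        _ ≤ 149 := h4
    have hb : ‖β‖ ≤ 7 * π / ell D ^ 9 := by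
      have : 7 * alpha D = 7 * π / ell D ^ 9 := by rw [hαeq]; ring
      rw [← this]; exact hβle
    have hℓ7 : (16688 : ℝ) ≤ ell D ^ 7 := by
      have : (400 : ℝ) ^ 7 ≤ ell D ^ 7 := pow_le_pow_left₀ (by norm_num) hℓ400 7
      linarith
    have key : 2 * 149 * ((1 + ell D) * ell D) * (7 * π) ≤ ell D ^ 9 := by
      have hq : (1 + ell D) * ell D ≤ 2 * ell D ^ 2 := by nlinarith
      calc 2 * 149 * ((1 + ell D) * ell D) * (7 * π) ≤ 2 * 149 * (2 * ell D ^ 2) * (7 * 4) := by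
            gcongr; exact Real.pi_lt_four.le
        _ = 16688 * ell D ^ 2 := by ring
        _ ≤ ell D ^ 7 * ell D ^ 2 := by gcongr
        _ = ell D ^ 9 := by ring
    have h1 : 2 * Real.exp (9 / 2) * (1 + ell D) * ell D * ‖β‖ ≤ 1 := by
      calc 2 * Real.exp (9 / 2) * (1 + ell D) * ell D * ‖β‖
          ≤ 2 * 149 * (1 + ell D) * ell D * (7 * π / ell D ^ 9) := by gcongr
        _ = 2 * 149 * ((1 + ell D) * ell D) * (7 * π) / ell D ^ 9 := by ring
        _ ≤ 1 := by rw [div_le_one (by positivity)]; exact key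
    calc ‖χ.LFunction (1 + β)‖ = ‖(χ.LFunction (1 + β) - χ.LFunction 1) + χ.LFunction 1‖ := by
          rw [sub_add_cancel]
      _ ≤ ‖χ.LFunction (1 + β) - χ.LFunction 1‖ + ‖χ.LFunction 1‖ := norm_add_le _ _
      _ ≤ 2 * Real.exp (9 / 2) * (1 + ell D) * ell D * ‖β‖ + 1 := add_le_add h hL1le
      _ ≤ 2 := by linarith
  -- (f5) `‖E(1+β)‖ ≤ C₀ 𝓛`
  have hE : ‖frakU2R c' χ j (1 + β)‖ ≤ C₀ * ell D := by
    have h := hv (1 + β) (by rw [add_sub_cancel_left]; exact hβinv)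
    exact h.trans (mul_le_mul_of_nonneg_right hCC₀ hℓpos.le)
  -- (f6)–(f8) the kernel factor `‖T^β ω₁(β)/β‖ ≤ 4/α ≤ 2𝓛⁹`
  have hT : ‖(bigT D : ℂ) ^ β‖ = 1 := by
    rw [Complex.norm_cpow_eq_rpow_re_of_pos (by rw [bigT]; exact Real.exp_pos _), hβre,
      Real.rpow_zero]
  have hω : ‖GaussWeight.omega1 (ell D ^ 30) β‖ ≤ 2 :=
    U055.norm_omega1_le_two (one_le_pow₀ (by linarith)) hβhalf
  have hker : ‖(bigT D : ℂ) ^ β * GaussWeight.omega1 (ell D ^ 30) β / β‖ ≤ 2 * ell D ^ 9 := by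
    rw [norm_div, norm_mul, hT, one_mul, div_le_iff₀ hβpos]
    have h1 : 2 * ell D ^ 9 * (alpha D / 2) = π := by rw [hαeq]; field_simp
    calc ‖GaussWeight.omega1 (ell D ^ 30) β‖ ≤ 2 := hω
      _ ≤ π := by linarith [Real.pi_gt_three]
      _ = 2 * ell D ^ 9 * (alpha D / 2) := h1.symm
      _ ≤ 2 * ell D ^ 9 * ‖β‖ := by gcongr
  -- the two values at `1 + β − β = 1`
  have e1 : (1 : ℂ) + β - β = 1 := add_sub_cancel_right 1 β
  rw [e1, riemannZeta₁_one]
  -- assemble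
  calc ‖riemannZeta (1 + β) ^ 2 * 1 * χ.LFunction (1 + β) * χ.LFunction 1 ^ 2 *
          frakU2R c' χ j (1 + β) *
          ((bigT D : ℂ) ^ β * GaussWeight.omega1 (ell D ^ 30) β / β)‖
        = ‖riemannZeta (1 + β)‖ ^ 2 * ‖χ.LFunction (1 + β)‖ * ‖χ.LFunction 1‖ ^ 2 *
            ‖frakU2R c' χ j (1 + β)‖ *
            ‖(bigT D : ℂ) ^ β * GaussWeight.omega1 (ell D ^ 30) β / β‖ := by
          simp only [norm_mul, norm_pow, mul_one]
    _ ≤ (ell D ^ 9) ^ 2 * 2 * (1 / ell D ^ 2022) ^ 2 * (C₀ * ell D) * (2 * ell D ^ 9) := by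
          gcongr
    _ = 4 * C₀ * ell D ^ 28 / ell D ^ 4044 := by
          field_simp
          ring
    _ ≤ (ell D ^ 4)⁻¹ := by
          rw [div_le_iff₀ (by positivity)]
          have h1 : (ell D ^ 4)⁻¹ * ell D ^ 4044 = ell D ^ 4040 := by
            field_simp
          rw [h1]
          have h2 : 4 * C₀ ≤ ell D := by linarith
          have h3 : (1 : ℝ) ≤ ell D := by linarith
          calc 4 * C₀ * ell D ^ 28 ≤ ell D * ell D ^ 28 := by gcongr
            _ = ell D ^ 29 := by ring
            _ ≤ ell D ^ 4040 := pow_le_pow_right₀ h3 (by norm_num)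

/-- The same bound in the owner's spelling `(φ β) β` with
`φ β := fun z ↦ ζ(1+z)²·ζ₁(1+z−β)·L(1+z,χ)·L(1+z−β,χ)²·E(1+z)·(T^z ω₁(z)/z)` (β-reduction only).
[cite: Zhang2022LandauSiegel, §16 p.94 (u041)] -/
theorem norm_resBeta_le' (c' : ℝ) (hRq : Lemma162Rq c') :
    ForAllLarge fun D _ χ => AssumptionA D χ → ∀ j ∈ ({1, 2} : Finset ℕ),
      ‖(fun z : ℂ => riemannZeta (1 + z) ^ 2 * riemannZeta₁ (1 + z - betaJ c' D j) *
          χ.LFunction (1 + z) * χ.LFunction (1 + z - betaJ c' D j) ^ 2 *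
          frakU2R c' χ j (1 + z) *
          ((bigT D : ℂ) ^ z * GaussWeight.omega1 (ell D ^ 30) z / z)) (betaJ c' D j)‖ ≤
        (ell D ^ 4)⁻¹ :=
  norm_resBeta_le c' hRq

end Literature.NumberTheory.LFunctions.Zhang2022.U041
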